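import Literature.Probability.LatticeModels.FKIsingObservableMartingale
import Literature.Probability.RandomPlanarGeometry.ObservableAdapted
import Literature.Probability.Process.NaturalFiltrationMartingale
import HarnessLib

/-!
# FK-Ising interfaces and SLE_{16/3}: the observable martingale in the natural filtration of the
driving process (layer 5: the monotone-class and optional-stopping bridge)

Topic `Literature/Probability/LatticeModels` (family `crit-ising`); theorems only (no definition,
no named fact). Fifth layer, identification half, of the decomposition of the named fact
`Literature.Probability.LatticeModels.convergesInLawToSLE_sixteen_thirds_fkInterface`
(**crit-ising.S17**, FK half; Chelkak–Duminil-Copin–Hongler–Kemppainen–Smirnov, C. R. Math. 352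
(2014), Thm. 2). Layer 4 (`FKIsingObservableMartingale.lean`) isolated **(L‴)**
`exists_observableMartingale_fkInterface`: for some version `W` of the driving process of a
subsequential limit and *some* filtration, the FK observable stopped at the far-field stopping
time `τ_y` is a martingale for all large `y`. The printed statement behind it (CDHKS 2014, §3) is

> "for any `z ∈ Ω`, the process `M_t(z) = (∂_z[-G_t(w(z))⁻¹])^{1/2}`, `t ≤ T(z)`, where
> `G_t(w) = g_t(w) - W_t` and `T(z) = (1/9)(Im w(z))²`, is a martingale with respect to the
> filtration `(ℱ_t)_{t≥0}` generated by `W_t`"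

(printed for the spin observable; for FK "the similar derivation of Theorem 2 from [Smi10] can
be found in [DCS12]", whose p. 29 reads "Since the convergence is uniform,
`M_t(z') := lim_{δ→0} M^δ_{τ_t}(z')` is a martingale … `√π M_t^z = √(g_t'(z)/(g_t(z) - W_t))` is
a martingale"), obtained there by passing the discrete observable martingales to the weak limit
against bounded continuous test functions — which produces the claim in *monotone-class* form
**(M5′)**: `E[(N^y_t - N^y_s) ψ(W_{S_0}, …, W_{S_{n-1}})] = 0` for the time-limited FK
observable process `N^y_t = O_{t ∧ y²/9}(iy)` (`Loewner.observableProcess`,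
`ObservableShortTime.lean`), all `s ≤ t`, all finite families of times `S_k ≤ s` and all
continuous `|ψ| ≤ 1`. This file PROVES, for an arbitrary real process `W` with strongly
measurable coordinates and continuous paths on a probability space, everything between (M5′)
and (L‴):

* `martingale_re_im_observableProcess_of_cylinder` — **(M5′) ⟹ (M5)**, the literal sentence:
  real and imaginary parts of `N^y` are martingales in the natural filtration
  `Filtration.natural W` (adaptedness of `N^y`, `Loewner.stronglyAdapted_observableProcess_natural`,
  `ObservableAdapted.lean`; the monotone-class theorem `Process.martingale_natural_of_integral_cylinder`,
  `NaturalFiltrationMartingale.lean`; integrability: `integrable_observableProcess`,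
  `integrable_cylinderIntegrand`);
* `martingale_re_im_stoppedObservable_natural_of_cylinder` — **(M5′) ⟹ the body of (L‴)** for
  this `W`, with the natural filtration and any level `y > 0`: optional stopping at
  `τ_y ≤ (y/128)² ≤ y²/9` (`Loewner.martingale_re_stoppedObservable`,
  `Loewner.martingale_im_stoppedObservable`, `ObservableDrivingMartingales.lean` /
  `ObservableShortTime.lean`: continuity of `t ↦ O_t(iy)` on `[0, y²/9]`, Le Gall Cor. 3.24 in a
  raw filtration). (CDHKS 2014, §3: from the displayed claim to "(5) is a martingale".)

The global consequences — (M5), (L‴), the identification fact (L) and crit-ising.S17 (FK) itself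
from the two printed inputs of CDHKS §3, namely (J) the Kemppainen–Smirnov conclusions with the
convergence of the driving processes and (D) the discrete observable martingales with Smirnov's
convergence theorem — are the theorems `exists_naturalObservableMartingale_fkInterface_of_limitData`,
`exists_observableMartingale_fkInterface_of_limitData`,
`isSLELaw_of_isSubseqLimitLaw_fkInterfaceCurve_of_limitData` and
`convergesInLawToSLE_sixteen_thirds_fkInterface_of_traversalBound_of_limitData` of
`FKIsingCylinderIdentityAssembly.lean`, where (J) and (D) are HYPOTHESES.

## D-0026 review record (2026-08-15)

Earlier versions of this file vendored (M5′) and (M5) as closed named facts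
(`exists_cylinderObservableIdentity_fkInterface`, `exists_naturalObservableMartingale_fkInterface`;
the latter already merged into a theorem with hypothesis (M5′) by a first review). The bad-split
review of (M5′) — its prove-seat had triaged it XL and asked to split it into Kemppainen–Smirnov's
theorem, DCS Lemma 6.6 and Smirnov's convergence theorem — found, with the sources open
(CDHKS arXiv:1312.0533, §3; Duminil-Copin–Smirnov arXiv:1109.1549, pp. 28–29, Thm. 3.15;
Kemppainen–Smirnov arXiv:1212.6215, Thm. 1.3, Cor. 1.5, Prop. 4.3): (i) the statement is a
faithful monotone-class weakening of the printed display and not an open problem; but (ii) it is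
not a published result with its own locator — it is a STEP of the parent's own printed proof
(the displayed claim of CDHKS §3 = one sentence of DCS p. 29), (iii) sitting one PROVED lemma
(`exists_cylinderIdentityData_of_limitData`, `FKIsingCylinderIdentityAssembly.lean`) above the
conjunction of two distinct published theorems that the tree does not yet hold and that are
theories of their own: Kemppainen–Smirnov 2017, Thm. 1.5 with Cor. 1.7 (arXiv Thm. 1.3,
Cor. 1.5), for the FK family via Prop. 4.3, and Smirnov 2010, Thm. 2.2 = DCS Thm. 3.15 in its
Carathéodory-uniform form ("uniformly over all possible domains `Ω^δ_n`"), plus DCS Lemma 6.6.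
Decompositions do not recurse (D-0026), so (M5′) was MERGED BACK into the parent's proof
obligation: no named fact remains in this file, the cylinder identity is the hypothesis `h` /
`hcyl` of the theorems here and in `FKIsingCylinderIdentityAssembly.lean`, and the named-fact
frontier of crit-ising.S17 (FK) is read at (C1) `fkInterface_traversalBound` and (L‴)
`exists_observableMartingale_fkInterface` (`FKIsingInterfaceSLEFrontier.lean`), with (J) ∧ (D)
below (L‴) as theorem hypotheses — the architecture of the spin half
(`InterfaceSLELimitData.lean`, `InterfaceSLEFrontier.lean`). The two missing theories are to enter
`Literature/` as first-class results under their own locators, not as decomposition children.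

## On faithfulness

(M5′)/(M5), now hypotheses and conclusions of theorems, transcribe the displayed sentence of
CDHKS §3 for the FK observable of DCS p. 29. Differences, all special cases or consequences of
the printed claims: (i) only points `z = iy` on the imaginary axis of `ℍ` (`= φ⁻¹(Ω)`), where the
principal square root of `iy g_t'/(g_t - W_t)` is the continuous branch for `t ≤ y²/9`
(`Loewner.ShortTime.base_mem_slitPlane`), and the `t`-independent normalisation by `√z`
(`Loewner.fkObservable`); (ii) the *raw* natural filtration `Filtration.natural W` (no
completion, no right limits: the printed "filtration generated by `W_t`" read literally; DCS
p. 29 states the martingale property for the curve filtration `𝒢_t = σ(γ̃[0, t])` — the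
natural-`W` form follows from either, `N^y` being `σ(W_{≤ t})`-measurable); (iii) the
cylinder/test-function form (M5′) is implied by the martingale property (the test functions are
bounded and `ℱ_s`-measurable) and is the form the printed proof produces.

## References

* D. Chelkak, H. Duminil-Copin, C. Hongler, A. Kemppainen, S. Smirnov, *Convergence of Ising
  interfaces to Schramm's SLE curves*, C. R. Math. Acad. Sci. Paris 352 (2014) 157–161
  (arXiv:1312.0533): Thm. 2, Thm. 3, §3.
* H. Duminil-Copin, S. Smirnov, *Conformal invariance of lattice models*, Clay Math. Proc. 15
  (2012) 213–276 (arXiv:1109.1549): Lemma 6.6, Thm. 3.15, Thm. 6.4, proof of Prop. 6.7 (p. 29).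
* A. Kemppainen, S. Smirnov, *Random curves, scaling limits and Loewner evolutions*, Ann.
  Probab. 45 (2017) 698–779 (arXiv:1212.6215): Thm. 1.3/1.5, Cor. 1.5/1.7, Prop. 3.8, Prop. 4.3.
* S. Smirnov, *Conformal invariance in random cluster models. I*, Ann. Math. 172 (2010), Thm. 2.2.
* J.-F. Le Gall, *Brownian Motion, Martingales, and Stochastic Calculus* (2016), Cor. 3.24.
-/

noncomputable section

open MeasureTheory Filter Topology Complex
open UpperHalfPlane (upperHalfPlaneSet)
open scoped NNReal ENNReal
open Literature.Probability.LatticeModels Literature.Probability.Percolation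

namespace Literature.Probability.LatticeModels

/-! ### (M5′) ⟹ (M5) ⟹ the body of (L‴): adaptedness, monotone class, optional stopping -/

section Bridge

open RandomPlanarGeometry RandomPlanarGeometry.Loewner

variable {Ω : Type*} {m : MeasurableSpace Ω} {P : Measure Ω} [IsProbabilityMeasure P]
  {W : ℝ≥0 → Ω → ℝ}

omit [IsProbabilityMeasure P] in
/-- The time-limited observable is integrable on a finite measure space (bounded by `2` and
measurable). [folklore] -/
theorem integrable_observableProcess [IsFiniteMeasure P] (hW : ∀ t, StronglyMeasurable (W t))
    (hWc : ∀ ω, Continuous (W · ω)) {y : ℝ} (hy : 0 < y) (t : ℝ≥0) :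
    Integrable (observableProcess W y t) P := by
  have hmeas : Measurable (observableProcess W y t) :=
    measurable_observableProcess hWc (fun s _ ↦ (hW s).measurable) hy
  exact (integrable_const (2 : ℝ)).mono' hmeas.aestronglyMeasurable
    (ae_of_all _ fun ω ↦ norm_observableProcess_le hWc hy t ω)

omit [IsProbabilityMeasure P] in
/-- The cylinder integrand `(N_t - N_s) ψ(W_S)` is integrable (bounded by `4`, measurable).
[folklore] -/
theorem integrable_cylinderIntegrand [IsFiniteMeasure P] (hW : ∀ t, StronglyMeasurable (W t))
    (hWc : ∀ ω, Continuous (W · ω)) {y : ℝ} (hy : 0 < y) (s t : ℝ≥0) {n : ℕ} (S : Fin n → ℝ≥0)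
    {ψ : (Fin n → ℝ) → ℝ} (hψc : Continuous ψ) (hψ1 : ∀ v, |ψ v| ≤ 1) :
    Integrable (fun ω ↦ (observableProcess W y t ω - observableProcess W y s ω) *
      (ψ (fun k ↦ W (S k) ω) : ℂ)) P := by
  have hV : Measurable fun ω ↦ (fun k ↦ W (S k) ω : Fin n → ℝ) :=
    measurable_pi_lambda _ fun k ↦ (hW (S k)).measurable
  have hψm : Measurable fun ω ↦ (ψ (fun k ↦ W (S k) ω) : ℂ) :=
    measurable_ofReal.comp (hψc.measurable.comp hV)
  have hN := fun r ↦ measurable_observableProcess (t := r) hWc (fun u _ ↦ (hW u).measurable) hy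
  refine (integrable_const (4 : ℝ)).mono' (((hN t).sub (hN s)).mul hψm).aestronglyMeasurable
    (ae_of_all _ fun ω ↦ ?_)
  rw [norm_mul, Complex.norm_real, Real.norm_eq_abs]
  have ht := norm_observableProcess_le hWc hy t ω
  have hs := norm_observableProcess_le hWc hy s ω
  have h1 : ‖observableProcess W y t ω - observableProcess W y s ω‖ ≤ 4 :=
    (norm_sub_le _ _).trans (by linarith)
  have h2 := hψ1 (fun k ↦ W (S k) ω)
  calc ‖observableProcess W y t ω - observableProcess W y s ω‖ * |ψ fun k ↦ W (S k) ω|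
      ≤ 4 * 1 := mul_le_mul h1 h2 (abs_nonneg _) (by norm_num)
    _ = 4 := by norm_num

/-- **Real and imaginary parts of the time-limited observable are natural-filtration martingales
as soon as the complex cylinder identity holds**: adaptedness
(`stronglyAdapted_observableProcess_natural`) + the monotone-class theorem
(`Process.martingale_natural_of_integral_cylinder`), after taking real and imaginary parts of the
complex identity (`integral_re`, `integral_im`). [folklore] -/
theorem martingale_re_im_observableProcess_of_cylinder (hW : ∀ t, StronglyMeasurable (W t))
    (hWc : ∀ ω, Continuous (W · ω)) {y : ℝ} (hy : 0 < y)
    (h : ∀ s t : ℝ≥0, s ≤ t → ∀ (n : ℕ) (S : Fin n → ℝ≥0), (∀ k, S k ≤ s) →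
      ∀ ψ : (Fin n → ℝ) → ℝ, Continuous ψ → (∀ v, |ψ v| ≤ 1) →
        ∫ ω, (observableProcess W y t ω - observableProcess W y s ω) *
          (ψ (fun k ↦ W (S k) ω) : ℂ) ∂P = 0) :
    Martingale (fun t ω ↦ (observableProcess W y t ω).re) (Filtration.natural W hW) P ∧
    Martingale (fun t ω ↦ (observableProcess W y t ω).im) (Filtration.natural W hW) P := by
  obtain ⟨-, hre, him⟩ := stronglyAdapted_observableProcess_natural hW hWc hy
  have hint := fun t ↦ integrable_observableProcess (P := P) hW hWc hy t
  constructor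
  · refine Process.martingale_natural_of_integral_cylinder hW hre (fun t ↦ (hint t).re)
      fun s t hst n S hS ψ hψc hψ1 ↦ ?_
    have hI := integrable_cylinderIntegrand (P := P) hW hWc hy s t S hψc hψ1
    have h0 := h s t hst n S hS ψ hψc hψ1
    have h1 := integral_re hI
    simp only [RCLike.re_to_complex, h0, Complex.zero_re] at h1
    rw [← h1]
    refine integral_congr_ae (ae_of_all _ fun ω ↦ ?_)
    simp only [Complex.re_mul_ofReal, Complex.sub_re]
  · refine Process.martingale_natural_of_integral_cylinder hW him (fun t ↦ (hint t).im)
      fun s t hst n S hS ψ hψc hψ1 ↦ ?_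
    have hI := integrable_cylinderIntegrand (P := P) hW hWc hy s t S hψc hψ1
    have h0 := h s t hst n S hS ψ hψc hψ1
    have h1 := integral_im hI
    simp only [RCLike.im_to_complex, h0, Complex.zero_im] at h1
    rw [← h1]
    refine integral_congr_ae (ae_of_all _ fun ω ↦ ?_)
    simp only [Complex.im_mul_ofReal, Complex.sub_im]


/-- **The cylinder identity implies the stopped-observable martingales of (L‴), locally.** For a
real process `W` with strongly measurable coordinates and continuous paths on a probability space
and a level `y > 0`: if the time-limited FK observable `N^y = observableProcess W y` satisfies
`E[(N^y_t - N^y_s) ψ(W_S)] = 0` for all `s ≤ t`, all finite families of times `S ≤ s` and all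
continuous `|ψ| ≤ 1` (the monotone-class form (M5′) of CDHKS §3's displayed claim), then the real
and imaginary parts of the FK observable stopped at the far-field stopping time `τ_y`
(`Loewner.stoppedObservable W y`) are martingales in the natural filtration of `W` — the body of
the layer-4 statement (L‴) `exists_observableMartingale_fkInterface` for this `W`, with
`𝓕 = Filtration.natural W`. Natural-filtration martingales by
`martingale_re_im_observableProcess_of_cylinder`, then optional stopping at
`τ_y ≤ (y/128)² ≤ y²/9` (`Loewner.martingale_re_stoppedObservable`,
`Loewner.martingale_im_stoppedObservable`; `W` is strongly adapted to its natural filtration).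
(CDHKS 2014, §3: from "`M_t(z)`, `t ≤ T(z)`, is a martingale" to "(5) is a martingale"; DCS 2012,
p. 29.) [cite: CDHKSCRAS2014, §3] [cite: DuminilCopinSmirnov2012Clay, Prop. 6.7 (proof, p. 29)] -/
theorem martingale_re_im_stoppedObservable_natural_of_cylinder (hW : ∀ t, StronglyMeasurable (W t))
    (hWc : ∀ ω, Continuous (W · ω)) {y : ℝ} (hy : 0 < y)
    (h : ∀ s t : ℝ≥0, s ≤ t → ∀ (n : ℕ) (S : Fin n → ℝ≥0), (∀ k, S k ≤ s) →
      ∀ ψ : (Fin n → ℝ) → ℝ, Continuous ψ → (∀ v, |ψ v| ≤ 1) →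
        ∫ ω, (observableProcess W y t ω - observableProcess W y s ω) *
          (ψ (fun k ↦ W (S k) ω) : ℂ) ∂P = 0) :
    Martingale (fun t ω ↦ (stoppedObservable W y t ω).re) (Filtration.natural W hW) P ∧
    Martingale (fun t ω ↦ (stoppedObservable W y t ω).im) (Filtration.natural W hW) P := by
  have hWad : StronglyAdapted (Filtration.natural W hW) W := Filtration.stronglyAdapted_natural hW
  obtain ⟨hre, him⟩ := martingale_re_im_observableProcess_of_cylinder hW hWc hy h
  exact ⟨martingale_re_stoppedObservable hWad hWc hy hre,
    martingale_im_stoppedObservable hWad hWc hy him⟩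

end Bridge

end Literature.Probability.LatticeModels
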